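import Summits.ResolutionOfSingularities.ResolutionOfSingularities.Theorems.ValuativeLuAlphaPTorsorToroidalExit

/-!
# `Valuative.LuAlphaPTorsor`, line `pfaff-line-log-final-forms`: the value-transcendental exit

Route `ResolutionOfSingularities/Valuative`, crux `LuAlphaPTorsor` (stmt-0641), stub
`stub_valueExit` of the lead's skeleton `Cruxes/LuAlphaPTorsor/Lines/pfaff-line-log-final-forms.lean`,
PROVED here (statement verbatim from the ledger registration).

**Statement.** `A₁ ⊆ O` a finitely generated `k`-subalgebra of the valued field `(K, O)`,
`char k = p`, regular at the centre `𝔭 = 𝔪_O ∩ A₁` with local ring `R = (A₁)_𝔭`, `t ∈ K` with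
`t ^ p ∈ A₁` and `Frac (A₁[t]) = K`. Suppose `c ∈ A₁` is such that the value `ν(t - c)` is NOT the
value of any element of `Frac A₁` (in particular `t ≠ c`), and that IN `K` one has a monomial
presentation `t ^ p - c ^ p = (∏ x_i ^ M_i) · w` with `x_i ∈ A₁` mapping to a regular system of
parameters of `R` (`span = 𝔪_R`, `d = dim R`) and `w, w⁻¹ ∈ A₁`. Then some finitely generated
`A ⊇ A₁` with `t ∈ A ⊆ O`, `Frac A = K` is regular at the centre.

**Proof.** Some `M_i` is prime to `p`: otherwise `G := ∏ x_i ^ (M_i / p) ∈ A₁` satisfies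
`(t - c) ^ p = t ^ p - c ^ p = G ^ p · w` (characteristic `p`), and `ν(w) = 1` (`w` is a unit of `O`;
`w ≠ 0` because `t ≠ c`), whence `ν(t - c) ^ p = ν(G) ^ p`, `ν(t - c) = ν(G)` (the value group is
torsion-free), contradicting the hypothesis on `c`. The images of `c, x_i, w` in `R` then form a
toroidal datum and the landed toroidal exit `stub_toroidalExit` concludes.
-/

noncomputable section

-- `Summit.<S>.<S>.…` duplicates the summit name by design (D-0017, single-problem summit).
set_option linter.dupNamespace false

open IsLocalRing

namespace Summit.ResolutionOfSingularities.ResolutionOfSingularities.Theorems.PfaffLine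

/-! ## §1 Glue -/

section Glue

variable {K : Type} [Field K]

/-- An element `w ≠ 0` of a valuation ring `O` whose inverse also lies in `O` has value `1`. -/
theorem valuation_eq_one_of_inv_mem (O : ValuationSubring K) {w : K} (hw0 : w ≠ 0) (hw : w ∈ O)
    (hwi : w⁻¹ ∈ O) : O.valuation w = 1 :=
  (O.valuation_eq_one_iff ⟨w, hw⟩).mp
    (IsUnit.of_mul_eq_one ⟨w⁻¹, hwi⟩ (Subtype.ext (mul_inv_cancel₀ hw0)))

/-- A power-product all of whose exponents are divisible by `p` is a `p`-th power. -/
theorem prod_pow_eq_pow_of_dvd {M₀ : Type*} [CommMonoid M₀] {d : ℕ} (x : Fin d → M₀)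
    (M : Fin d → ℕ) {p : ℕ} (h : ∀ i, p ∣ M i) :
    ∏ i, x i ^ M i = (∏ i, x i ^ (M i / p)) ^ p := by
  rw [← Finset.prod_pow]
  refine Finset.prod_congr rfl fun i _ => ?_
  rw [← pow_mul, Nat.div_mul_cancel (h i)]

end Glue

/-! ## §2 The stub -/

/-- **Stub `stub_valueExit` of the line `pfaff-line-log-final-forms`** (crux
`Valuative.LuAlphaPTorsor`, stmt-0641): the value-transcendental exit — if `ν(t - c)` is not the
value of an element of `Frac A₁` and `t ^ p - c ^ p = x^M · w` is monomial in a regular system of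
parameters `x` of the centre with `w` a unit, then some exponent `M_i` is prime to `p` and the
toroidal exit applies. See the module docstring for the proof. -/
theorem stub_valueExit :
    ∀ p : ℕ, p.Prime → ∀ (k K : Type) [Field k] [CharP k p] [Field K] [Algebra k K] (O : ValuationSubring K) (A₁ : Subalgebra k K) (h₁ : A₁.toSubring ≤ O.toSubring) (t : K), A₁.FG → ∀ (htp : t ^ p ∈ A₁), IsFractionRing (Algebra.adjoin k (insert t (A₁ : Set K))) K → IsRegularLocalRing (Localization.AtPrime (Ideal.comap (Subring.inclusion h₁) (IsLocalRing.maximalIdeal O))) → ∀ (c : K), c ∈ A₁ → (∀ z : K, z ∈ Subfield.closure (A₁ : Set K) → O.valuation (t - c) ≠ O.valuation z) → (∃ (d : ℕ) (x : Fin d → K) (hx : ∀ i, x i ∈ A₁) (M : Fin d → ℕ) (w : K), w ∈ A₁ ∧ w⁻¹ ∈ A₁ ∧ Ideal.span (Set.range fun i => algebraMap A₁.toSubring (Localization.AtPrime (Ideal.comap (Subring.inclusion h₁) (IsLocalRing.maximalIdeal O))) ⟨x i, hx i⟩) = IsLocalRing.maximalIdeal (Localization.AtPrime (Ideal.comap (Subring.inclusion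 h₁) (IsLocalRing.maximalIdeal O))) ∧ ringKrullDim (Localization.AtPrime (Ideal.comap (Subring.inclusion h₁) (IsLocalRing.maximalIdeal O))) = (d : WithBot ℕ∞) ∧ t ^ p - c ^ p = (Finset.univ.prod fun i => x i ^ M i) * w) → ∃ (A : Subalgebra k K) (h : A.toSubring ≤ O.toSubring), A₁ ≤ A ∧ t ∈ A ∧ A.FG ∧ IsFractionRing A K ∧ IsRegularLocalRing (Localization.AtPrime (Ideal.comap (Subring.inclusion h) (IsLocalRing.maximalIdeal O))) := by
  intro p hp k K _ _ _ _ O A₁ h₁ t hfg htp hfr hreg c hc hval hdat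
  obtain ⟨d, x, hx, M, w, hw, hwi, hspan, hdim, hident⟩ := hdat
  classical
  haveI := Fact.mk hp
  have hp0 : p ≠ 0 := hp.ne_zero
  haveI : CharP K p := charP_of_injective_algebraMap (algebraMap k K).injective p
  -- `A₁ ⊆ Frac A₁`
  have hsub : ∀ z ∈ A₁, z ∈ Subfield.closure (A₁ : Set K) := fun z hz =>
    Subfield.subset_closure hz
  -- ### characteristic `p`: `(t - c) ^ p = x^M · w`
  have htc : (t - c) ^ p = (∏ i, x i ^ M i) * w := by
    rw [sub_pow_char]
    exact hident
  -- ### `w ≠ 0` (else `t = c`, and `ν(t - c) = ν(0)`), so `ν(w) = 1`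
  have hw0 : w ≠ 0 := by
    intro hw0
    rw [hw0, mul_zero] at htc
    have h0 : t - c = 0 := (pow_eq_zero_iff hp0).mp htc
    exact hval 0 (hsub 0 A₁.zero_mem) (by rw [h0])
  have hvw : O.valuation w = 1 := valuation_eq_one_of_inv_mem O hw0 (h₁ hw) (h₁ hwi)
  -- ### some exponent is prime to `p`
  have hndvd : ∃ i, ¬ p ∣ M i := by
    by_contra hall
    push Not at hall
    have hGA : ∏ i, x i ^ (M i / p) ∈ A₁ := A₁.prod_mem fun i _ => A₁.pow_mem (hx i) _
    have hGp : (t - c) ^ p = (∏ i, x i ^ (M i / p)) ^ p * w := by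
      rw [htc, prod_pow_eq_pow_of_dvd x M hall]
    have hveq : O.valuation (t - c) ^ p = O.valuation (∏ i, x i ^ (M i / p)) ^ p := by
      rw [← map_pow, ← map_pow, hGp, map_mul, hvw, mul_one]
    exact hval _ (hsub _ hGA) (pow_left_injective hp0 hveq)
  obtain ⟨i₀, hi₀⟩ := hndvd
  -- ### the toroidal datum in `R = (A₁)_𝔭`
  have hunit : IsUnit (algebraMap A₁.toSubring
      (Localization.AtPrime (Ideal.comap (Subring.inclusion h₁) (maximalIdeal O))) ⟨w, hw⟩) := by
    refine IsUnit.map _ (IsUnit.of_mul_eq_one ⟨w⁻¹, hwi⟩ (Subtype.ext ?_))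
    exact mul_inv_cancel₀ hw0
  have hidA : (⟨t ^ p, htp⟩ : A₁.toSubring) - ⟨c, hc⟩ ^ p = (∏ i, ⟨x i, hx i⟩ ^ M i) * ⟨w, hw⟩ := by
    apply Subtype.ext
    push_cast
    exact hident
  have hidR : algebraMap A₁.toSubring
        (Localization.AtPrime (Ideal.comap (Subring.inclusion h₁) (maximalIdeal O))) ⟨t ^ p, htp⟩ -
      (algebraMap A₁.toSubring
        (Localization.AtPrime (Ideal.comap (Subring.inclusion h₁) (maximalIdeal O))) ⟨c, hc⟩) ^ p =
      (Finset.univ.prod fun i => (algebraMap A₁.toSubring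
        (Localization.AtPrime (Ideal.comap (Subring.inclusion h₁) (maximalIdeal O))) ⟨x i, hx i⟩) ^ M i) *
      algebraMap A₁.toSubring
        (Localization.AtPrime (Ideal.comap (Subring.inclusion h₁) (maximalIdeal O))) ⟨w, hw⟩ := by
    have := congrArg (algebraMap A₁.toSubring
      (Localization.AtPrime (Ideal.comap (Subring.inclusion h₁) (maximalIdeal O)))) hidA
    rw [map_sub, map_pow, map_mul, map_prod] at this
    simpa only [map_pow] using this
  exact stub_toroidalExit p hp k K O A₁ h₁ t hfg htp hfr hreg
    ⟨_, d, _, M, _, hspan, hdim, hunit, ⟨i₀, hi₀⟩, hidR⟩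

end Summit.ResolutionOfSingularities.ResolutionOfSingularities.Theorems.PfaffLine

end
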